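import Literature.Analysis.FluidPDE.NSLerayHopfProofs
import Literature.Analysis.FluidPDE.UniqueContinuationGaussian
import Literature.Analysis.FluidPDE.EssCurry
import HarnessLib

/-!
# Unique continuation through spatial boundaries (Escauriaza–Seregin–Šverák 2003, Thm. 4.1), proved

Analysis/FluidPDE proofs file (theorems only) discharging the named fact
`Literature.Analysis.FluidPDE.ess_unique_continuation` of `NSLerayHopfProofs.lean`
(L. Escauriaza, G. Seregin, V. Šverák, Russ. Math. Surveys 58:2 (2003), Thm. 4.1; the printed
proof followed here is G. Seregin, *Lecture notes on regularity theory for the Navier–Stokes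
equations*, World Scientific 2014, App. A.2, Thm. 2.4 with Lemma A.1, pp. 210–212): a `C²`
function `u` on `Q(R, T) = B(R) × ]0, T[`, continuous up to `t = 0`, with
`|∂ₜu + Δu| ≤ c₁(|u| + |∇u|)` and vanishing to infinite order at the origin,
`|u(x, t)| ≤ C_k(|x| + √t)^k` for all `k`, satisfies `u(x, 0) = 0` for all `x ∈ B(R)`.

Seregin: "Theorem 2.4 is an easy consequence of the following lemma" (Lemma A.1, the Gaussian
decay `|u(x, t)| ≤ c e^{-|x|²/4t}` for `|x| ≤ β₁R`, `β₂t ≤ |x|²`, `t ≤ γT`, proved in the tree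
as `Carleman.exists_gaussian_decay` from the first Carleman inequality; Remark A.1:
"`u(x, 0) = 0` if `|x| ≤ β₁R`"). The passage from `B(β₁R)` to the whole ball `B(R)` is the
following propagation argument, which we carry out: the Gaussian decay near `(x₁, 0)` makes
every point `(x₂, 0)` with `0 < |x₂ - x₁| ≤ β₁(R - |x₁|)/2` again a zero of infinite order
(`local_vanishing_of_gaussian`; together with the global bound `|u| ≤ C₀`, the `k = 0` case of
the hypothesis, this gives (A.2.3) on the whole cylinder centred at `x₂`,
`vanishing_order_of_local`), so Lemma A.1 applies again at `x₂` with radius `R - |x₂|`; by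
induction the set of zeros of infinite order on `t = 0` contains the balls of radii
`R(1 - (1 - β₁/2)^N)`, `N = 0, 1, …`, which exhaust `B(R)`; finally `u(x, 0) = 0` at a zero of
infinite order by continuity up to `t = 0`.

* `Carleman.vanishing_order_of_local`, `Carleman.local_vanishing_of_gaussian` — the two
  elementary steps above;
* `Carleman.uniqueContinuation_uncurried` — Thm. 2.4 for uncurried `u : ℝ × ℝⁿ → ℝᵐ` in the
  frame calculus of `CarlemanCalculus.lean`;
* `ess_unique_continuation_holds` — the discharge, through the dictionary of `EssCurry.lean`
  (`∂ₜ = dt`, `Δ = lap`, `‖D(u t)(x)‖ ≤ |∇u|`).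

The hypothesis (4.1) (`W^{2,1}_2` integrability) of the named fact is not needed for `C²`
functions vanishing to infinite order (the `k = 0` case bounds `u`, and the interior gradient
estimate bounds `∇u`).

## References

* L. Escauriaza, G. Seregin, V. Šverák, *`L_{3,∞}`-solutions of Navier–Stokes equations and
  backward uniqueness*, Russ. Math. Surveys 58:2 (2003) 211–250, §4, Thm. 4.1.
* G. Seregin, *Lecture notes on regularity theory for the Navier–Stokes equations*, World
  Scientific 2014, App. A.2, Thm. 2.4, Lemma A.1, Remark A.1, pp. 210–212.
-/

noncomputable section

open MeasureTheory Set Function Filter Metric InnerProductSpace Laplacian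
open _root_.Topology
open scoped InnerProductSpace RealInnerProductSpace Nat

namespace Literature.Analysis.FluidPDE

namespace Carleman

section Propagation

variable {E : Type*} [NormedAddCommGroup E]
variable {F : Type*} [NormedAddCommGroup F]

/-- **From local to global vanishing order.** If `|U| ≤ M` on `S` and `U` vanishes to
infinite order at `(0, x₁)` locally (for each `k`, `|U(z)| ≤ C(|z.2 - x₁| + √z.1)^k` for
`z ∈ S` close to `(0, x₁)`), then (A.2.3) holds on all of `S`:
`|U(z)| ≤ C'(|z.2 - x₁| + √z.1)^k` for `z ∈ S`. [cite: Seregin2014, App. A.2 (A.2.3)] -/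
theorem vanishing_order_of_local {U : ℝ × E → F} {S : Set (ℝ × E)} {x₁ : E} {M : ℝ}
    (hM : ∀ z ∈ S, ‖U z‖ ≤ M)
    (hloc : ∀ k : ℕ, ∃ C r : ℝ, 0 < r ∧ ∀ z ∈ S, ‖z.2 - x₁‖ < r → z.1 < r →
      ‖U z‖ ≤ C * (‖z.2 - x₁‖ + Real.sqrt z.1) ^ k) (k : ℕ) :
    ∃ C : ℝ, ∀ z ∈ S, ‖U z‖ ≤ C * (‖z.2 - x₁‖ + Real.sqrt z.1) ^ k := by
  obtain ⟨C, r, hr, hC⟩ := hloc k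
  set r₀ : ℝ := min r (Real.sqrt r) with hr₀
  have hr₀0 : 0 < r₀ := lt_min hr (Real.sqrt_pos.2 hr)
  set M' : ℝ := max M 0 with hM'
  have hM'0 : 0 ≤ M' := le_max_right _ _
  refine ⟨max C 0 + M' / r₀ ^ k, fun z hz => ?_⟩
  set b : ℝ := ‖z.2 - x₁‖ + Real.sqrt z.1 with hb
  have hb0 : 0 ≤ b := by positivity
  have hbk : 0 ≤ b ^ k := pow_nonneg hb0 k
  have hn1 : 0 ≤ max C 0 * b ^ k := mul_nonneg (le_max_right _ _) hbk
  have hn2 : 0 ≤ M' / r₀ ^ k * b ^ k := by positivity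
  by_cases h : ‖z.2 - x₁‖ < r ∧ z.1 < r
  · calc ‖U z‖ ≤ C * b ^ k := hC z hz h.1 h.2
      _ ≤ max C 0 * b ^ k := mul_le_mul_of_nonneg_right (le_max_left _ _) hbk
      _ ≤ (max C 0 + M' / r₀ ^ k) * b ^ k := by rw [add_mul]; linarith
  · have hbr : r₀ ≤ b := by
      rcases not_and_or.1 h with h1 | h1
      · calc r₀ ≤ r := min_le_left _ _
          _ ≤ ‖z.2 - x₁‖ := not_lt.1 h1
          _ ≤ b := le_add_of_nonneg_right (Real.sqrt_nonneg _)
      · calc r₀ ≤ Real.sqrt r := min_le_right _ _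
          _ ≤ Real.sqrt z.1 := Real.sqrt_le_sqrt (not_lt.1 h1)
          _ ≤ b := le_add_of_nonneg_left (norm_nonneg _)
    have hratio : 1 ≤ (b / r₀) ^ k := one_le_pow₀ ((one_le_div hr₀0).2 hbr)
    calc ‖U z‖ ≤ M := hM z hz
      _ ≤ M' := le_max_left _ _
      _ ≤ M' * (b / r₀) ^ k := le_mul_of_one_le_right hM'0 hratio
      _ = M' / r₀ ^ k * b ^ k := by rw [div_pow]; ring
      _ ≤ (max C 0 + M' / r₀ ^ k) * b ^ k := by rw [add_mul]; linarith

/-- **Gaussian decay propagates the vanishing order** (the step from Remark A.1 to Thm. 2.4):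
if near `(0, x₁)` the function satisfies the Gaussian bound of Lemma A.1,
`|U(z)| ≤ K e^{-|z.2 - x₁|²/(8 z.1)}` for `z ∈ S` with `z.1 ≤ t_max`, `|z.2 - x₁| ≤ L`,
`β₂ z.1 ≤ |z.2 - x₁|²`, then every `x₂ ≠ x₁` with `3|x₂ - x₁| ≤ 2L` is a zero of infinite
order: for each `k`, `|U(z)| ≤ C(|z.2 - x₂| + √z.1)^k` for `z ∈ S` near `(0, x₂)`
(`e^{-ℓ²/32s} ≤ k!(32s/ℓ²)^k`, `ℓ = |x₂ - x₁|`). [cite: Seregin2014, App. A.2 Remark A.1] -/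
theorem local_vanishing_of_gaussian {U : ℝ × E → F} {S : Set (ℝ × E)} {x₁ x₂ : E}
    {Kf L β₂ tmax : ℝ} (htmax : 0 < tmax) (hβ₂ : 0 < β₂) (hx : x₂ ≠ x₁)
    (hx2 : 3 * ‖x₂ - x₁‖ ≤ 2 * L)
    (hgauss : ∀ z ∈ S, z.1 ≤ tmax → ‖z.2 - x₁‖ ≤ L → β₂ * z.1 ≤ ‖z.2 - x₁‖ ^ 2 →
      ‖U z‖ ≤ Kf * Real.exp (-(‖z.2 - x₁‖ ^ 2 / (8 * z.1))))
    (hS : ∀ z ∈ S, 0 < z.1) (k : ℕ) :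
    ∃ C r : ℝ, 0 < r ∧ ∀ z ∈ S, ‖z.2 - x₂‖ < r → z.1 < r →
      ‖U z‖ ≤ C * (‖z.2 - x₂‖ + Real.sqrt z.1) ^ k := by
  set ℓ : ℝ := ‖x₂ - x₁‖ with hℓ
  have hℓ0 : 0 < ℓ := norm_pos_iff.2 (sub_ne_zero.2 hx)
  set r : ℝ := min (ℓ / 2) (min tmax (min (ℓ ^ 2 / (4 * β₂)) 1)) with hr
  have hr0 : 0 < r := lt_min (by positivity) (lt_min htmax (lt_min (by positivity) one_pos))
  have hrℓ : r ≤ ℓ / 2 := min_le_left _ _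
  have hrt : r ≤ tmax := (min_le_right _ _).trans (min_le_left _ _)
  have hrβ : r ≤ ℓ ^ 2 / (4 * β₂) :=
    ((min_le_right _ _).trans (min_le_right _ _)).trans (min_le_left _ _)
  have hr1 : r ≤ 1 := ((min_le_right _ _).trans (min_le_right _ _)).trans (min_le_right _ _)
  set Kf' : ℝ := max Kf 0 with hKf'def
  have hKf' : Kf ≤ Kf' := le_max_left _ _
  have hKf'0 : 0 ≤ Kf' := le_max_right _ _
  refine ⟨Kf' * k ! * 32 ^ k / ℓ ^ (2 * k), r, hr0, fun z hz hzx hzt => ?_⟩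
  have hs : 0 < z.1 := hS z hz
  -- distances to `x₁`
  have hd1 : ℓ / 2 ≤ ‖z.2 - x₁‖ := by
    have h1 : ℓ ≤ ‖z.2 - x₂‖ + ‖z.2 - x₁‖ := by
      calc ℓ = ‖(x₂ - z.2) + (z.2 - x₁)‖ := by rw [hℓ, sub_add_sub_cancel]
        _ ≤ ‖x₂ - z.2‖ + ‖z.2 - x₁‖ := norm_add_le _ _
        _ = ‖z.2 - x₂‖ + ‖z.2 - x₁‖ := by rw [norm_sub_rev]
    linarith
  have hd2 : ‖z.2 - x₁‖ ≤ L := by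
    have h1 : ‖z.2 - x₁‖ ≤ ‖z.2 - x₂‖ + ‖x₂ - x₁‖ := norm_sub_le_norm_sub_add_norm_sub _ _ _
    linarith
  have hsq4 : (ℓ / 2) ^ 2 ≤ ‖z.2 - x₁‖ ^ 2 := pow_le_pow_left₀ (by positivity) hd1 2
  have hd3 : β₂ * z.1 ≤ ‖z.2 - x₁‖ ^ 2 := by
    have h1 : β₂ * z.1 ≤ β₂ * r := mul_le_mul_of_nonneg_left hzt.le hβ₂.le
    have h2 : β₂ * r ≤ ℓ ^ 2 / 4 := by
      calc β₂ * r ≤ β₂ * (ℓ ^ 2 / (4 * β₂)) := mul_le_mul_of_nonneg_left hrβ hβ₂.le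
        _ = ℓ ^ 2 / 4 := by field_simp
    have h3 : (ℓ / 2) ^ 2 = ℓ ^ 2 / 4 := by ring
    linarith
  have hg := hgauss z hz (hzt.le.trans hrt) hd2 hd3
  -- `e^{-|z.2 - x₁|²/8s} ≤ e^{-ℓ²/32s} ≤ k! (32 s)^k / ℓ^{2k}`
  set q : ℝ := ℓ ^ 2 / (32 * z.1) with hq
  have hq0 : 0 < q := by positivity
  have he1 : Real.exp (-(‖z.2 - x₁‖ ^ 2 / (8 * z.1))) ≤ Real.exp (-q) := by
    rw [Real.exp_le_exp, neg_le_neg_iff, hq, div_le_div_iff₀ (by positivity) (by positivity)]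
    have h3 : (ℓ / 2) ^ 2 * (32 * z.1) = ℓ ^ 2 * (8 * z.1) := by ring
    calc ℓ ^ 2 * (8 * z.1) = (ℓ / 2) ^ 2 * (32 * z.1) := h3.symm
      _ ≤ ‖z.2 - x₁‖ ^ 2 * (32 * z.1) := mul_le_mul_of_nonneg_right hsq4 (by positivity)
  have he2 : Real.exp (-q) ≤ k ! / q ^ k := by
    rw [le_div_iff₀ (pow_pos hq0 k), mul_comm]
    exact pow_mul_exp_neg_le_factorial hq0.le k
  have he3 : (k ! : ℝ) / q ^ k = k ! * 32 ^ k / ℓ ^ (2 * k) * z.1 ^ k := by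
    have hℓk : ℓ ^ (2 * k) ≠ 0 := pow_ne_zero _ hℓ0.ne'
    have hsk : z.1 ^ k ≠ 0 := pow_ne_zero _ hs.ne'
    rw [hq, div_pow, mul_pow, ← pow_mul]
    field_simp
  -- `s^k ≤ (|z.2 - x₂| + √s)^k` (`s ≤ 1`)
  have hsk : z.1 ^ k ≤ (‖z.2 - x₂‖ + Real.sqrt z.1) ^ k := by
    have hs1 : z.1 ≤ 1 := hzt.le.trans hr1
    have h1 : z.1 ≤ Real.sqrt z.1 := by
      have h2 : Real.sqrt z.1 ≤ 1 := by
        rw [show (1 : ℝ) = Real.sqrt 1 from Real.sqrt_one.symm]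
        exact Real.sqrt_le_sqrt hs1
      calc z.1 = Real.sqrt z.1 * Real.sqrt z.1 := (Real.mul_self_sqrt hs.le).symm
        _ ≤ Real.sqrt z.1 * 1 := mul_le_mul_of_nonneg_left h2 (Real.sqrt_nonneg _)
        _ = Real.sqrt z.1 := mul_one _
    have h2 : Real.sqrt z.1 ≤ ‖z.2 - x₂‖ + Real.sqrt z.1 := le_add_of_nonneg_left (norm_nonneg _)
    exact pow_le_pow_left₀ hs.le (h1.trans h2) k
  calc ‖U z‖ ≤ Kf * Real.exp (-(‖z.2 - x₁‖ ^ 2 / (8 * z.1))) := hg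
    _ ≤ Kf' * Real.exp (-(‖z.2 - x₁‖ ^ 2 / (8 * z.1))) :=
        mul_le_mul_of_nonneg_right hKf' (Real.exp_pos _).le
    _ ≤ Kf' * (k ! / q ^ k) := mul_le_mul_of_nonneg_left (he1.trans he2) hKf'0
    _ = Kf' * k ! * 32 ^ k / ℓ ^ (2 * k) * z.1 ^ k := by rw [he3]; ring
    _ ≤ Kf' * k ! * 32 ^ k / ℓ ^ (2 * k) * (‖z.2 - x₂‖ + Real.sqrt z.1) ^ k :=
        mul_le_mul_of_nonneg_left hsk (by positivity)

end Propagation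

/-- **Unique continuation across spatial boundaries, uncurried form** (Escauriaza–Seregin–
Šverák 2003, Thm. 4.1 = Seregin 2014, App. A.2, Thm. 2.4, for `C²` functions): let
`U : ℝ × ℝⁿ → ℝᵐ` be `C²` on `]0, T[ × B(0, R)`, continuous on `[0, T[ × B(0, R)`, with
`|∂ₜU + ΔU| ≤ c₁(|U| + |∇U|)` on the open cylinder (`c₁ ≥ 0`) and `|U(z)| ≤ C_k(|z.2| + √z.1)^k`
there for every `k`. Then `U(0, x) = 0` for all `x ∈ B(0, R)`. Proof: Lemma A.1
(`exists_gaussian_decay`) at the centres of an increasing family of balls (Seregin: "Theorem 2.4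
is an easy consequence of" Lemma A.1), see the module docstring. [cite: Seregin2014, App. A.2 Thm. 2.4] -/
theorem uniqueContinuation_uncurried (n m : ℕ) {c₁ R T : ℝ} (hc₁ : 0 ≤ c₁) (hR : 0 < R)
    (hT : 0 < T) {U : ℝ × EuclideanSpace ℝ (Fin n) → EuclideanSpace ℝ (Fin m)}
    (hU : ContDiffOn ℝ 2 U (Ioo 0 T ×ˢ ball 0 R))
    (hUc : ContinuousOn U (Ico 0 T ×ˢ ball 0 R))
    (hineq : ∀ z ∈ Ioo 0 T ×ˢ ball (0 : EuclideanSpace ℝ (Fin n)) R,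
      ‖dt U z + lap U z‖ ≤ c₁ * (‖U z‖ + Real.sqrt (gradSq U z)))
    (hvan : ∀ k : ℕ, ∃ C : ℝ, ∀ z ∈ Ioo 0 T ×ˢ ball (0 : EuclideanSpace ℝ (Fin n)) R,
      ‖U z‖ ≤ C * (‖z.2‖ + Real.sqrt z.1) ^ k) :
    ∀ x ∈ ball (0 : EuclideanSpace ℝ (Fin n)) R, U (0, x) = 0 := by
  intro x hx
  obtain ⟨β₁, β₂, γ, hβ₁0, hβ₁1, hβ₂0, hγ0, -, hG⟩ := exists_gaussian_decay n m hc₁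
  -- ## the global bound `M` (the case `k = 0`)
  obtain ⟨C₀, hC₀⟩ := hvan 0
  set M : ℝ := max C₀ 0 with hMdef
  have hM0 : 0 ≤ M := le_max_right _ _
  have hM : ∀ z ∈ Ioo 0 T ×ˢ ball (0 : EuclideanSpace ℝ (Fin n)) R, ‖U z‖ ≤ M := by
    intro z hz
    have h := hC₀ z hz
    rw [pow_zero, mul_one] at h
    exact h.trans (le_max_left _ _)
  -- ## the local vanishing predicate and its propagation
  set LV : EuclideanSpace ℝ (Fin n) → Prop := fun x₁ => ∀ k : ℕ, ∃ C r : ℝ, 0 < r ∧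
    ∀ z ∈ Ioo 0 T ×ˢ ball (0 : EuclideanSpace ℝ (Fin n)) R, ‖z.2 - x₁‖ < r → z.1 < r →
      ‖U z‖ ≤ C * (‖z.2 - x₁‖ + Real.sqrt z.1) ^ k with hLV
  have hLV0 : LV 0 := by
    intro k
    obtain ⟨C, hC⟩ := hvan k
    refine ⟨C, 1, one_pos, fun z hz _ _ => ?_⟩
    simpa only [sub_zero] using hC z hz
  have hprop : ∀ x₁ ∈ ball (0 : EuclideanSpace ℝ (Fin n)) R, LV x₁ →
      ∀ x₂ : EuclideanSpace ℝ (Fin n), ‖x₂ - x₁‖ ≤ β₁ / 2 * (R - ‖x₁‖) → LV x₂ := by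
    intro x₁ hx₁ hL x₂ hx₂
    rw [mem_ball, dist_zero_right] at hx₁
    set R₁ : ℝ := R - ‖x₁‖ with hR₁
    have hR₁0 : 0 < R₁ := by rw [hR₁]; linarith
    have hsub : Ioo 0 T ×ˢ ball x₁ R₁ ⊆ Ioo 0 T ×ˢ ball (0 : EuclideanSpace ℝ (Fin n)) R := by
      refine prod_mono subset_rfl fun y hy => ?_
      rw [mem_ball, dist_eq_norm] at hy
      rw [mem_ball, dist_zero_right]
      calc ‖y‖ = ‖(y - x₁) + x₁‖ := by rw [sub_add_cancel]
        _ ≤ ‖y - x₁‖ + ‖x₁‖ := norm_add_le _ _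
        _ < R := by rw [hR₁] at hy; linarith
    -- (A.2.3) on the whole cylinder centred at `x₁`
    have hvan₁ : ∀ k : ℕ, ∃ C : ℝ, ∀ z ∈ Ioo 0 T ×ˢ ball x₁ R₁,
        ‖U z‖ ≤ C * (‖z.2 - x₁‖ + Real.sqrt z.1) ^ k :=
      vanishing_order_of_local (fun z hz => hM z (hsub hz)) fun k => by
        obtain ⟨C, r, hr, h⟩ := hL k
        exact ⟨C, r, hr, fun z hz => h z (hsub hz)⟩
    -- Lemma A.1 at `x₁`
    obtain ⟨Kf, hKf⟩ := hG U x₁ R₁ T M hR₁0 hT hM0 (hU.mono hsub)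
      (fun z hz => hineq z (hsub hz)) (fun z hz => hM z (hsub hz)) hvan₁
    by_cases hx₂₁ : x₂ = x₁
    · rw [hx₂₁]; exact hL
    · refine local_vanishing_of_gaussian (S := Ioo 0 T ×ˢ ball (0 : EuclideanSpace ℝ (Fin n)) R)
        (Kf := Kf) (tmax := min (γ * T) γ) (L := β₁ * R₁) (lt_min (by positivity) hγ0) hβ₂0 hx₂₁
        (by linarith [mul_pos hβ₁0 hR₁0]) ?_ (fun z hz => hz.1.1)
      intro z hz ht hxz hβz
      have h := hKf z.1 z.2 hz.1.1 (ht.trans (min_le_left _ _)) (ht.trans (min_le_right _ _))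
        hxz hβz
      simpa only [Prod.mk.eta] using h
  -- ## the induction over the radii `R(1 - (1 - θ)^N)`, `θ = β₁/2`
  set θ : ℝ := β₁ / 2 with hθ
  have hθ0 : 0 < θ := by positivity
  have hθ1 : θ < 1 := by rw [hθ]; linarith
  have hiter : ∀ N : ℕ, ∀ y : EuclideanSpace ℝ (Fin n),
      ‖y‖ ≤ R * (1 - (1 - θ) ^ N) → ‖y‖ < R → LV y := by
    intro N
    induction N with
    | zero =>
      intro y hy _
      have h0 : y = 0 := by
        have h : ‖y‖ ≤ 0 := by simpa using hy
        exact norm_le_zero_iff.1 h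
      rw [h0]
      exact hLV0
    | succ N ih =>
      intro y hy hyR
      set rN : ℝ := R * (1 - (1 - θ) ^ N) with hrN
      by_cases hle : ‖y‖ ≤ rN
      · exact ih y hle hyR
      · rw [not_le] at hle
        have hq0 : 0 < (1 - θ) ^ N := pow_pos (by linarith) N
        have hq1 : (1 - θ) ^ N ≤ 1 := pow_le_one₀ (by linarith) (by linarith)
        have hrN0 : 0 ≤ rN := by rw [hrN]; exact mul_nonneg hR.le (by linarith)
        have hrNR : rN < R := by
          rw [hrN]
          have : R * (1 - (1 - θ) ^ N) = R - R * (1 - θ) ^ N := by ring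
          rw [this]
          linarith [mul_pos hR hq0]
        have hy0 : 0 < ‖y‖ := lt_of_le_of_lt hrN0 hle
        set y₁ : EuclideanSpace ℝ (Fin n) := (rN / ‖y‖) • y with hy₁
        have hny₁ : ‖y₁‖ = rN := by
          rw [hy₁, norm_smul, Real.norm_of_nonneg (div_nonneg hrN0 hy0.le),
            div_mul_cancel₀ _ hy0.ne']
        have hLV₁ : LV y₁ := ih y₁ (by rw [hny₁]) (by rw [hny₁]; exact hrNR)
        have hdist : ‖y - y₁‖ = ‖y‖ - rN := by
          have e : y - y₁ = (1 - rN / ‖y‖) • y := by rw [hy₁, sub_smul, one_smul]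
          have hc : 0 ≤ 1 - rN / ‖y‖ := by
            rw [sub_nonneg, div_le_one hy0]; exact hle.le
          rw [e, norm_smul, Real.norm_of_nonneg hc, sub_mul, one_mul, div_mul_cancel₀ _ hy0.ne']
        refine hprop y₁ (by rw [mem_ball, dist_zero_right, hny₁]; exact hrNR) hLV₁ y ?_
        rw [hdist, hny₁]
        have e : R * (1 - (1 - θ) ^ (N + 1)) - rN = θ * (R - rN) := by rw [hrN]; ring
        linarith
  -- ## every point of `B(0, R)` is a zero of infinite order
  rw [mem_ball, dist_zero_right] at hx
  obtain ⟨N, hN⟩ : ∃ N : ℕ, (1 - θ) ^ N < 1 - ‖x‖ / R :=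
    exists_pow_lt_of_lt_one (by rw [sub_pos, div_lt_one hR]; exact hx) (by linarith)
  have hxN : ‖x‖ ≤ R * (1 - (1 - θ) ^ N) := by
    have h1 : ‖x‖ / R < 1 - (1 - θ) ^ N := by linarith
    rw [div_lt_iff₀ hR] at h1
    linarith
  have hLVx : LV x := hiter N x hxN hx
  -- ## conclusion by continuity up to `t = 0`
  obtain ⟨C, r, hr, hC⟩ := hLVx 1
  have hxmem : ((0 : ℝ), x) ∈ Ico 0 T ×ˢ ball (0 : EuclideanSpace ℝ (Fin n)) R :=
    ⟨⟨le_rfl, hT⟩, by rwa [mem_ball, dist_zero_right]⟩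
  have hcw : ContinuousWithinAt U (Ico 0 T ×ˢ ball (0 : EuclideanSpace ℝ (Fin n)) R) (0, x) :=
    hUc _ hxmem
  have hpath : Tendsto (fun s : ℝ => ((s, x) : ℝ × EuclideanSpace ℝ (Fin n))) (𝓝[Ioo 0 T] 0)
      (𝓝[Ico 0 T ×ˢ ball (0 : EuclideanSpace ℝ (Fin n)) R] (0, x)) := by
    apply tendsto_nhdsWithin_of_tendsto_nhds_of_eventually_within
    · exact ((continuous_id.prodMk continuous_const).tendsto 0).mono_left nhdsWithin_le_nhds
    · filter_upwards [self_mem_nhdsWithin] with s hs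
      exact ⟨Ioo_subset_Ico_self hs, by rwa [mem_ball, dist_zero_right]⟩
  have hlim : Tendsto (fun s : ℝ => ‖U (s, x)‖) (𝓝[Ioo 0 T] 0) (𝓝 ‖U (0, x)‖) :=
    (hcw.tendsto.comp hpath).norm
  have hbound : ∀ᶠ s in 𝓝[Ioo 0 T] 0, ‖U (s, x)‖ ≤ C * Real.sqrt s := by
    have hmem : Ioo 0 (min r T) ∈ 𝓝[Ioo 0 T] (0 : ℝ) := by
      rw [nhdsWithin_Ioo_eq_nhdsGT hT]
      exact Ioo_mem_nhdsGT (lt_min hr hT)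
    filter_upwards [hmem] with s hs
    have hz : ((s, x) : ℝ × EuclideanSpace ℝ (Fin n)) ∈
        Ioo 0 T ×ˢ ball (0 : EuclideanSpace ℝ (Fin n)) R :=
      ⟨⟨hs.1, hs.2.trans_le (min_le_right _ _)⟩, by rwa [mem_ball, dist_zero_right]⟩
    have h := hC (s, x) hz (by simp [hr]) (hs.2.trans_le (min_le_left _ _))
    simpa using h
  have hsqrt : Tendsto (fun s : ℝ => C * Real.sqrt s) (𝓝[Ioo 0 T] 0) (𝓝 0) := by
    have h := ((Real.continuous_sqrt.tendsto 0).const_mul C).mono_left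
      (nhdsWithin_le_nhds (s := Ioo (0 : ℝ) T) (a := (0 : ℝ)))
    simpa using h
  haveI : (𝓝[Ioo 0 T] (0 : ℝ)).NeBot := by
    rw [nhdsWithin_Ioo_eq_nhdsGT hT]; infer_instance
  have hle : ‖U (0, x)‖ ≤ 0 := le_of_tendsto_of_tendsto hlim hsqrt hbound
  exact norm_le_zero_iff.1 hle

end Carleman

/-- Local notation for physical space `ℝ³ = EuclideanSpace ℝ (Fin 3)`. -/
local notation "ℝ³" => EuclideanSpace ℝ (Fin 3)

/-- **Escauriaza–Seregin–Šverák 2003, Thm. 4.1 (unique continuation through spatial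
boundaries), proved**: discharge of the named fact `ess_unique_continuation`
(`NSLerayHopfProofs.lean`) — the `C²` special case of ESS Thm. 4.1 = Seregin 2014, App. A.2,
Thm. 2.4: on `Q(R, T) = B(R) × ]0, T[ ⊆ ℝ³ × ℝ`, a jointly `C²` `u`, continuous up to `t = 0`,
with `|∂ₜu + Δu| ≤ c₁(|u| + |∇u|)` and `|u(x, t)| ≤ C_k(|x| + √t)^k` for all `k`, satisfies
`u(x, 0) = 0` for all `x ∈ B(R)`. From `Carleman.uniqueContinuation_uncurried` through the
dictionary of `EssCurry.lean`; the constant `c₁` is replaced by `max(c₁, 0)` and the operator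
norm `‖D(u t)(x)‖` is bounded by the frame gradient `|∇u|`. The integrability hypothesis (4.1)
is not used. [cite: EscauriazaSereginSverak2003, Thm. 4.1] [cite: Seregin2014, App. A.2 Thm. 2.4] -/
theorem ess_unique_continuation_holds : ess_unique_continuation := by
  intro m R T hR hT u c₁ hC2 hcont _ hineq hvan
  set c : ℝ := max c₁ 0 with hc
  have hc0 : 0 ≤ c := le_max_right _ _
  have hopen : IsOpen (Ioo (0 : ℝ) T ×ˢ ball (0 : ℝ³) R) := isOpen_Ioo.prod isOpen_ball
  have hineq' : ∀ z ∈ Ioo (0 : ℝ) T ×ˢ ball (0 : ℝ³) R,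
      ‖Carleman.dt (uncurry u) z + Carleman.lap (uncurry u) z‖ ≤
        c * (‖uncurry u z‖ + Real.sqrt (Carleman.gradSq (uncurry u) z)) := by
    rintro ⟨t, y⟩ hz
    have hd : DifferentiableAt ℝ (uncurry u) (t, y) :=
      (hC2.differentiableOn (by norm_num)).differentiableAt (hopen.mem_nhds hz)
    rw [Carleman.dt_uncurry hd, Carleman.lap_uncurry hopen hz hC2]
    have h1 := hineq t hz.1 y hz.2
    have h2 : ‖fderiv ℝ (u t) y‖ ≤ Real.sqrt (Carleman.gradSq (uncurry u) (t, y)) :=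
      Carleman.opNorm_fderiv_le_sqrt_gradSq hd
    have h3 : 0 ≤ ‖u t y‖ + ‖fderiv ℝ (u t) y‖ := by positivity
    calc ‖FluidPDE.timeDeriv u t y + Δ (u t) y‖ ≤ c₁ * (‖u t y‖ + ‖fderiv ℝ (u t) y‖) := h1
      _ ≤ c * (‖u t y‖ + ‖fderiv ℝ (u t) y‖) := mul_le_mul_of_nonneg_right (le_max_left _ _) h3
      _ ≤ c * (‖u t y‖ + Real.sqrt (Carleman.gradSq (uncurry u) (t, y))) := by gcongr
      _ = c * (‖uncurry u (t, y)‖ + Real.sqrt (Carleman.gradSq (uncurry u) (t, y))) := rfl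
  have hvan' : ∀ k : ℕ, ∃ C : ℝ, ∀ z ∈ Ioo (0 : ℝ) T ×ˢ ball (0 : ℝ³) R,
      ‖uncurry u z‖ ≤ C * (‖z.2‖ + Real.sqrt z.1) ^ k := by
    intro k
    obtain ⟨C, hC⟩ := hvan k
    exact ⟨C, fun z hz => hC z.1 hz.1 z.2 hz.2⟩
  exact Carleman.uniqueContinuation_uncurried 3 m hc0 hR hT hC2 hcont hineq' hvan'

end Literature.Analysis.FluidPDE
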